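import Summits.RiemannHypothesis.RiemannHypothesis.Theorems.SemilocalDeletionSchurFloor
import HarnessLib

/-!
# Two SPREAD primes: the deletion floor is the Perron root `ρ₄ = (w₂ + √(w₂² + 4w₁²))/2 < w₁ + w₂`

First explicit instance of the Schur floor of `SemilocalDeletionSchurFloor.lean` that is STRICTLY better than the sum of the
single-prime cliffs.  Let `p₁ ≠ p₂` be primes in `S`, `L_i = log p_i`, `w_i = log p_i/√p_i`, and `g ∈ C(c)` with `c < L₁ ≤ L₂`
and the SPREAD condition `2c < 2L₂ − L₁`.  Then the orbit graph of the two lags on `[−c, c]` is a union of 4-node paths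
`x + L₁ — x — x + L₂ — x + L₂ − L₁` (edge weights `w₁, w₂, w₁`) and shorter pieces, its spectral radius is the positive root
`ρ₄` of `ρ² = w₂ρ + w₁²`, and the piecewise-constant weight `φ = 1` on the outer slivers `[−c, c − L₂] ∪ [L₂ − c, c]`, `φ = w₁/ρ₄`
inside, is a Schur weight with constant `ρ₄` (§1, pure interval bookkeeping).  Hence (§2–§3)

  `Re Q_{S∖{p₁,p₂}}(g) ≥ Re Q_S(g) − ρ₄‖g‖₂²`,   `λ_min(S∖{p₁,p₂}; c; P) ≥ λ_min(S; c; P) − ρ₄`,   `ρ₄ < w₁ + w₂`.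

Certified numerics (rh-explicit, lineage E, kit j194848, b = 9/5, U = {p ≤ 31}, N = 200, free-odd sector; BLIND cells of
handoff-idea-1's PRED-CLIFF19-ORBIT PART O): `U∖{11,23}`: bottom `−1.11254` vs `−ρ₄ = −1.12033` (sum floor `−1.37676`);
`U∖{13,23}`: `−1.10378` vs `−ρ₄ = −1.10980` (sum `−1.36519`); `U∖{7,31}`, `U∖{19,29}`, `U∖{23,31}` (cramped outer slivers):
`−0.954 / −0.907 / −0.875` above `−ρ₄ = −1.106 / −1.057 / −1.031`.  The floor is never violated and is met to `0.006–0.008`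
where the outer slivers have room.  Nothing here bears on RH.
-/

set_option linter.dupNamespace false

noncomputable section

open Complex Filter Set MeasureTheory
open scoped Real Topology ComplexConjugate

namespace Summit.RiemannHypothesis.RiemannHypothesis.Theorems.SemilocalDeletionPairFloor

open Literature.NumberTheory.LFunctions
open Summit.RiemannHypothesis.RiemannHypothesis.Theorems.SemilocalDeletionCliff
open Summit.RiemannHypothesis.RiemannHypothesis.Theorems.SemilocalDeletionSchurFloor
open Summit.RiemannHypothesis.RiemannHypothesis.Theorems.HandoffSemilocalEnergy

variable {g : ℝ → ℂ} {c L₁ L₂ w₁ w₂ ρ θ : ℝ}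

/-! ## §1  The Schur weight of the spread two-lag configuration -/

/-- The weight: `1` on the two outer slivers `[−c, c − L₂] ∪ [L₂ − c, c]` (where a `±L₂` move exists), `θ` on the inner part
`(c − L₂, L₂ − c)` of the window, `0` outside the window. Written as an indicator of an `ite` (no new definition). -/
theorem pairWeight_measurable (c L₂ θ : ℝ) :
    Measurable fun x : ℝ ↦ (Icc (-c) c).indicator (fun x ↦ if x ∈ Ioo (c - L₂) (L₂ - c) then θ else (1 : ℝ)) x :=
  (Measurable.ite measurableSet_Ioo measurable_const measurable_const).indicator measurableSet_Icc

/-- Values of the weight: outside the window it is `0`. -/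
theorem pairWeight_of_not_mem {x : ℝ} (hx : x ∉ Icc (-c) c) :
    (Icc (-c) c).indicator (fun x ↦ if x ∈ Ioo (c - L₂) (L₂ - c) then θ else (1 : ℝ)) x = 0 :=
  Set.indicator_of_notMem hx _

/-- Values of the weight: on the inner part it is `θ`. -/
theorem pairWeight_of_inner {x : ℝ} (hx : x ∈ Icc (-c) c) (hin : x ∈ Ioo (c - L₂) (L₂ - c)) :
    (Icc (-c) c).indicator (fun x ↦ if x ∈ Ioo (c - L₂) (L₂ - c) then θ else (1 : ℝ)) x = θ := by
  rw [Set.indicator_of_mem hx]; exact if_pos hin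

/-- Values of the weight: on the outer slivers it is `1`. -/
theorem pairWeight_of_outer {x : ℝ} (hx : x ∈ Icc (-c) c) (hout : x ∉ Ioo (c - L₂) (L₂ - c)) :
    (Icc (-c) c).indicator (fun x ↦ if x ∈ Ioo (c - L₂) (L₂ - c) then θ else (1 : ℝ)) x = 1 := by
  rw [Set.indicator_of_mem hx]; exact if_neg hout

/-- The weight takes values in `[0, 1]` when `0 ≤ θ ≤ 1`. -/
theorem pairWeight_mem_Icc (hθ0 : 0 ≤ θ) (hθ1 : θ ≤ 1) (x : ℝ) :
    (Icc (-c) c).indicator (fun x ↦ if x ∈ Ioo (c - L₂) (L₂ - c) then θ else (1 : ℝ)) x ∈ Icc (0 : ℝ) 1 := by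
  by_cases hx : x ∈ Icc (-c) c
  · rw [Set.indicator_of_mem hx]
    by_cases hin : x ∈ Ioo (c - L₂) (L₂ - c)
    · rw [if_pos hin]; exact ⟨hθ0, hθ1⟩
    · rw [if_neg hin]; exact ⟨zero_le_one, le_rfl⟩
  · rw [Set.indicator_of_notMem hx]; exact ⟨le_rfl, zero_le_one⟩

/-- **The Schur inequality for two SPREAD lags.** Let `c < L₁`, `L₂` with `2c < 2L₂ − L₁` (the lags are spread: the
orbit graph of `{L₁, L₂}` on `[−c, c]` consists of 4-node paths `x + L₁ — x — x + L₂ — x + L₂ − L₁` and shorter pieces), weights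
`w₁ ≥ 0`, `w₂`, and `ρ > 0`, `θ = w₁/ρ ≤ 1` with the Perron inequality `w₁² + w₂ρ ≤ ρ²`.  Then the weight `φ` (1 on the outer
slivers, `θ` inside) satisfies `w₁(φ(x − L₁) + φ(x + L₁)) + w₂(φ(x − L₂) + φ(x + L₂)) ≤ ρ·φ(x)` on the window. -/
theorem pairWeight_schur (hc1 : c < L₁) (hstar : 2 * c < 2 * L₂ - L₁)
    (hw₁ : 0 ≤ w₁) (hρ : 0 < ρ) (hθ : θ = w₁ / ρ) (hθ1 : θ ≤ 1) (hP : w₁ ^ 2 + w₂ * ρ ≤ ρ ^ 2)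
    {x : ℝ} (hx : x ∈ Icc (-c) c) :
    w₁ * ((Icc (-c) c).indicator (fun x ↦ if x ∈ Ioo (c - L₂) (L₂ - c) then θ else (1 : ℝ)) (x - L₁) +
        (Icc (-c) c).indicator (fun x ↦ if x ∈ Ioo (c - L₂) (L₂ - c) then θ else (1 : ℝ)) (x + L₁)) +
      w₂ * ((Icc (-c) c).indicator (fun x ↦ if x ∈ Ioo (c - L₂) (L₂ - c) then θ else (1 : ℝ)) (x - L₂) +
        (Icc (-c) c).indicator (fun x ↦ if x ∈ Ioo (c - L₂) (L₂ - c) then θ else (1 : ℝ)) (x + L₂)) ≤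
      ρ * (Icc (-c) c).indicator (fun x ↦ if x ∈ Ioo (c - L₂) (L₂ - c) then θ else (1 : ℝ)) x := by
  set φ : ℝ → ℝ := fun x ↦ (Icc (-c) c).indicator (fun x ↦ if x ∈ Ioo (c - L₂) (L₂ - c) then θ else (1 : ℝ)) x with hφ
  have hθ0 : 0 ≤ θ := by rw [hθ]; exact div_nonneg hw₁ hρ.le
  have hφ01 : ∀ y, φ y ∈ Icc (0 : ℝ) 1 := fun y ↦ pairWeight_mem_Icc hθ0 hθ1 y
  have hwθ : w₁ * θ + w₂ ≤ ρ := by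
    rw [hθ]
    have : w₁ * (w₁ / ρ) + w₂ = (w₁ ^ 2 + w₂ * ρ) / ρ := by field_simp
    rw [this, div_le_iff₀ hρ]
    nlinarith
  have hρθ : ρ * θ = w₁ := by rw [hθ]; field_simp
  rw [mem_Icc] at hx
  show w₁ * (φ (x - L₁) + φ (x + L₁)) + w₂ * (φ (x - L₂) + φ (x + L₂)) ≤ ρ * φ x
  by_cases hP1 : x ≤ c - L₂
  · -- left outer sliver: +L₁ → inner (θ), +L₂ → right outer sliver (1), −L₁, −L₂ outside
    have hxW : x ∈ Icc (-c) c := mem_Icc.2 hx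
    have hφx : φ x = 1 := pairWeight_of_outer hxW (fun h ↦ by rw [mem_Ioo] at h; linarith [h.1])
    have h1 : φ (x - L₁) = 0 := pairWeight_of_not_mem (fun h ↦ by rw [mem_Icc] at h; linarith [h.1])
    have h2 : φ (x - L₂) = 0 := pairWeight_of_not_mem (fun h ↦ by rw [mem_Icc] at h; linarith [h.1])
    have h3 : φ (x + L₁) = θ := pairWeight_of_inner (mem_Icc.2 ⟨by linarith, by linarith⟩)
      (mem_Ioo.2 ⟨by linarith, by linarith⟩)
    have h4 : φ (x + L₂) = 1 := pairWeight_of_outer (mem_Icc.2 ⟨by linarith, by linarith⟩)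
      (fun h ↦ by rw [mem_Ioo] at h; linarith [h.2])
    rw [hφx, h1, h2, h3, h4]; linarith
  by_cases hQ1 : L₂ - c ≤ x
  · -- right outer sliver: −L₂ → left outer (1), −L₁ → inner (θ), +L₁, +L₂ outside
    have hxW : x ∈ Icc (-c) c := mem_Icc.2 hx
    have hφx : φ x = 1 := pairWeight_of_outer hxW (fun h ↦ by rw [mem_Ioo] at h; linarith [h.2])
    have h1 : φ (x + L₁) = 0 := pairWeight_of_not_mem (fun h ↦ by rw [mem_Icc] at h; linarith [h.2])
    have h2 : φ (x + L₂) = 0 := pairWeight_of_not_mem (fun h ↦ by rw [mem_Icc] at h; linarith [h.2])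
    have h3 : φ (x - L₁) = θ := pairWeight_of_inner (mem_Icc.2 ⟨by linarith, by linarith⟩)
      (mem_Ioo.2 ⟨by linarith, by linarith⟩)
    have h4 : φ (x - L₂) = 1 := pairWeight_of_outer (mem_Icc.2 ⟨by linarith, by linarith⟩)
      (fun h ↦ by rw [mem_Ioo] at h; linarith [h.1])
    rw [hφx, h1, h2, h3, h4]; linarith
  · -- inner part: no ±L₂ neighbour, at most one ±L₁ neighbour (weight ≤ 1)
    push Not at hP1 hQ1
    have hxW : x ∈ Icc (-c) c := mem_Icc.2 hx
    have hφx : φ x = θ := pairWeight_of_inner hxW (mem_Ioo.2 ⟨hP1, hQ1⟩)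
    have h2 : φ (x - L₂) = 0 := pairWeight_of_not_mem (fun h ↦ by rw [mem_Icc] at h; linarith [h.1])
    have h4 : φ (x + L₂) = 0 := pairWeight_of_not_mem (fun h ↦ by rw [mem_Icc] at h; linarith [h.2])
    have h13 : φ (x - L₁) + φ (x + L₁) ≤ 1 := by
      by_cases hm : L₁ - c ≤ x
      · -- then x + L₁ > c is outside
        have : φ (x + L₁) = 0 := pairWeight_of_not_mem (fun h ↦ by rw [mem_Icc] at h; linarith [h.2])
        rw [this, add_zero]; exact (hφ01 _).2
      · have : φ (x - L₁) = 0 := pairWeight_of_not_mem (fun h ↦ by rw [mem_Icc] at h; push Not at hm; linarith [h.1])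
        rw [this, zero_add]; exact (hφ01 _).2
    rw [hφx, h2, h4, add_zero, mul_zero, add_zero, hρθ]
    calc w₁ * (φ (x - L₁) + φ (x + L₁)) ≤ w₁ * 1 := mul_le_mul_of_nonneg_left h13 hw₁
      _ = w₁ := mul_one _

/-! ## §2  The pair floor -/

variable {S : Finset ℕ} {p₁ p₂ : ℕ}

/-- **TWO SPREAD PRIMES: the Schur floor with an explicit Perron constant.** Let `p₁ ≠ p₂` be primes in `S` with
`c < log p₁ ≤ log p₂` and `2c < 2 log p₂ − log p₁`, `g ∈ C(c)`, `wᵢ = log pᵢ/√pᵢ`, and `ρ > 0` with `w₁ ≤ ρ` and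
`w₁² + w₂ρ ≤ ρ²`.  Then `Re Q_{S∖{p₁,p₂}}(g) ≥ Re Q_S(g) − ρ‖g‖₂²`.  (The least such `ρ` is the Perron root
`(w₂ + √(w₂² + 4w₁²))/2 < w₁ + w₂` of the 4-node path with edge weights `(w₁, w₂, w₁)` — next theorem.) -/
theorem re_weilSemilocalQuadratic_sdiff_pair_ge (hg : IsWeilTest g) (hsupp : tsupport g ⊆ Icc (-c) c)
    (hp₁ : p₁.Prime) (hp₂ : p₂.Prime) (h1S : p₁ ∈ S) (h2S : p₂ ∈ S) (hne : p₁ ≠ p₂)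
    (hc1 : c < Real.log p₁) (h12 : Real.log p₁ ≤ Real.log p₂) (hstar : 2 * c < 2 * Real.log p₂ - Real.log p₁)
    (hρ : 0 < ρ) (hρ1 : Real.log p₁ / Real.sqrt p₁ ≤ ρ)
    (hP : (Real.log p₁ / Real.sqrt p₁) ^ 2 + Real.log p₂ / Real.sqrt p₂ * ρ ≤ ρ ^ 2) :
    (weilSemilocalQuadratic S g).re - ρ * ∫ x : ℝ, ‖g x‖ ^ 2 ≤ (weilSemilocalQuadratic (S \ {p₁, p₂}) g).re := by
  set w₁ : ℝ := Real.log p₁ / Real.sqrt p₁ with hw₁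
  set w₂ : ℝ := Real.log p₂ / Real.sqrt p₂ with hw₂
  have hw₁0 : 0 ≤ w₁ := div_nonneg (Real.log_nonneg (by exact_mod_cast hp₁.one_lt.le)) (Real.sqrt_nonneg _)
  set θ : ℝ := w₁ / ρ with hθ
  have hθ1 : θ ≤ 1 := by rw [hθ, div_le_one hρ]; exact hρ1
  have hw₁pos : 0 < w₁ := div_pos (Real.log_pos (by exact_mod_cast hp₁.one_lt)) (Real.sqrt_pos.2 (by exact_mod_cast hp₁.pos))
  have hθpos : 0 < θ := by rw [hθ]; exact div_pos hw₁pos hρ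
  have hDS : ({p₁, p₂} : Finset ℕ) ⊆ S := by
    intro p hp
    simp only [Finset.mem_insert, Finset.mem_singleton] at hp
    rcases hp with rfl | rfl
    · exact h1S
    · exact h2S
  have hprime : ∀ p ∈ ({p₁, p₂} : Finset ℕ), p.Prime := by
    intro p hp
    simp only [Finset.mem_insert, Finset.mem_singleton] at hp
    rcases hp with rfl | rfl
    · exact hp₁
    · exact hp₂
  have hlog : ∀ p ∈ ({p₁, p₂} : Finset ℕ), c < Real.log p := by
    intro p hp
    simp only [Finset.mem_insert, Finset.mem_singleton] at hp
    rcases hp with rfl | rfl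
    · exact hc1
    · exact hc1.trans_le h12
  refine re_weilSemilocalQuadratic_sdiff_ge_of_schur hg hsupp {p₁, p₂} hDS hprime hlog
    (φ := fun x ↦ (Icc (-c) c).indicator (fun x ↦ if x ∈ Ioo (c - Real.log p₂) (Real.log p₂ - c) then θ else (1 : ℝ)) x)
    (M := 1) (m := θ) (pairWeight_measurable c (Real.log p₂) θ) (fun x ↦ (pairWeight_mem_Icc hθpos.le hθ1 x).1)
    (fun x ↦ (pairWeight_mem_Icc hθpos.le hθ1 x).2) hθpos (fun x hx ↦ ?_) (fun x hx ↦ ?_)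
  · -- φ ≥ θ on the window
    by_cases hin : x ∈ Ioo (c - Real.log p₂) (Real.log p₂ - c)
    · rw [pairWeight_of_inner hx hin]
    · rw [pairWeight_of_outer hx hin]; exact hθ1
  · rw [Finset.sum_pair hne]
    exact pairWeight_schur hc1 hstar hw₁0 hρ hθ hθ1 hP hx

/-- The Perron root of the 4-path: `ρ₄ = (w₂ + √(w₂² + 4w₁²))/2` satisfies `w₁² + w₂ρ₄ = ρ₄²`, `w₁ ≤ ρ₄`, `0 < ρ₄` (for `w₁ > 0`,
`w₂ ≥ 0`) and is STRICTLY below the sum `w₁ + w₂` when `w₂ > 0`. -/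
theorem perronFour_spec (hw₁ : 0 < w₁) (hw₂ : 0 ≤ w₂) :
    w₁ ^ 2 + w₂ * ((w₂ + Real.sqrt (w₂ ^ 2 + 4 * w₁ ^ 2)) / 2) = ((w₂ + Real.sqrt (w₂ ^ 2 + 4 * w₁ ^ 2)) / 2) ^ 2 ∧
      w₁ ≤ (w₂ + Real.sqrt (w₂ ^ 2 + 4 * w₁ ^ 2)) / 2 ∧ 0 < (w₂ + Real.sqrt (w₂ ^ 2 + 4 * w₁ ^ 2)) / 2 := by
  have hs : 0 ≤ w₂ ^ 2 + 4 * w₁ ^ 2 := by positivity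
  have hsq := Real.sq_sqrt hs
  have h2w : 2 * w₁ ≤ Real.sqrt (w₂ ^ 2 + 4 * w₁ ^ 2) := by
    rw [show 2 * w₁ = Real.sqrt ((2 * w₁) ^ 2) by rw [Real.sqrt_sq (by linarith)]]
    exact Real.sqrt_le_sqrt (by nlinarith)
  refine ⟨by nlinarith [hsq], by linarith, by linarith⟩

/-- `ρ₄ < w₁ + w₂` for positive weights: deleting two spread primes costs STRICTLY LESS than the sum of the two single cliffs. -/
theorem perronFour_lt_add (hw₁ : 0 < w₁) (hw₂ : 0 < w₂) :
    (w₂ + Real.sqrt (w₂ ^ 2 + 4 * w₁ ^ 2)) / 2 < w₁ + w₂ := by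
  have hs : 0 ≤ w₂ ^ 2 + 4 * w₁ ^ 2 := by positivity
  have hlt : Real.sqrt (w₂ ^ 2 + 4 * w₁ ^ 2) < 2 * w₁ + w₂ := by
    rw [show 2 * w₁ + w₂ = Real.sqrt ((2 * w₁ + w₂) ^ 2) by rw [Real.sqrt_sq (by linarith)]]
    exact Real.sqrt_lt_sqrt hs (by nlinarith)
  linarith

/-- **THE PAIR FLOOR with the Perron constant.** Under the hypotheses of `re_weilSemilocalQuadratic_sdiff_pair_ge`:
`Re Q_{S∖{p₁,p₂}}(g) ≥ Re Q_S(g) − ρ₄‖g‖₂²`, `ρ₄ = (w₂ + √(w₂² + 4w₁²))/2`. -/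
theorem re_weilSemilocalQuadratic_sdiff_pair_ge_perron (hg : IsWeilTest g) (hsupp : tsupport g ⊆ Icc (-c) c)
    (hp₁ : p₁.Prime) (hp₂ : p₂.Prime) (h1S : p₁ ∈ S) (h2S : p₂ ∈ S) (hne : p₁ ≠ p₂)
    (hc1 : c < Real.log p₁) (h12 : Real.log p₁ ≤ Real.log p₂) (hstar : 2 * c < 2 * Real.log p₂ - Real.log p₁) :
    (weilSemilocalQuadratic S g).re -
        (Real.log p₂ / Real.sqrt p₂ + Real.sqrt ((Real.log p₂ / Real.sqrt p₂) ^ 2 + 4 * (Real.log p₁ / Real.sqrt p₁) ^ 2)) / 2 *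
          ∫ x : ℝ, ‖g x‖ ^ 2 ≤
      (weilSemilocalQuadratic (S \ {p₁, p₂}) g).re := by
  have hw₁ : 0 < Real.log p₁ / Real.sqrt p₁ :=
    div_pos (Real.log_pos (by exact_mod_cast hp₁.one_lt)) (Real.sqrt_pos.2 (by exact_mod_cast hp₁.pos))
  have hw₂ : 0 ≤ Real.log p₂ / Real.sqrt p₂ :=
    div_nonneg (Real.log_nonneg (by exact_mod_cast hp₂.one_lt.le)) (Real.sqrt_nonneg _)
  obtain ⟨hP, hρ1, hρ⟩ := perronFour_spec hw₁ hw₂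
  exact re_weilSemilocalQuadratic_sdiff_pair_ge hg hsupp hp₁ hp₂ h1S h2S hne hc1 h12 hstar hρ hρ1 hP.le

/-! ## §3  Energy language -/

variable {P : (ℝ → ℂ) → Prop}

/-- **Pair floor for the bottoms.** `λ_min(S∖{p₁,p₂}; c; P) ≥ λ_min(S; c; P) − ρ₄` for every constraint `P`, under the spread
condition `2c < 2 log p₂ − log p₁` (`c < log p₁ ≤ log p₂`, `p₁ ≠ p₂` primes in `S`). -/
theorem semilocalGroundEnergy_sdiff_pair_ge (hp₁ : p₁.Prime) (hp₂ : p₂.Prime) (h1S : p₁ ∈ S) (h2S : p₂ ∈ S)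
    (hne : p₁ ≠ p₂) (hc1 : c < Real.log p₁) (h12 : Real.log p₁ ≤ Real.log p₂)
    (hstar : 2 * c < 2 * Real.log p₂ - Real.log p₁) :
    semilocalGroundEnergy S P c -
        (Real.log p₂ / Real.sqrt p₂ + Real.sqrt ((Real.log p₂ / Real.sqrt p₂) ^ 2 + 4 * (Real.log p₁ / Real.sqrt p₁) ^ 2)) / 2 ≤
      semilocalGroundEnergy (S \ {p₁, p₂}) P c := by
  have hw₁ : 0 < Real.log p₁ / Real.sqrt p₁ :=
    div_pos (Real.log_pos (by exact_mod_cast hp₁.one_lt)) (Real.sqrt_pos.2 (by exact_mod_cast hp₁.pos))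
  have hw₂ : 0 ≤ Real.log p₂ / Real.sqrt p₂ :=
    div_nonneg (Real.log_nonneg (by exact_mod_cast hp₂.one_lt.le)) (Real.sqrt_nonneg _)
  obtain ⟨_, _, hρ⟩ := perronFour_spec hw₁ hw₂
  rcases (semilocalSphereValues (S \ {p₁, p₂}) P c).eq_empty_or_nonempty with he | hne'
  · have he' : semilocalSphereValues S P c = ∅ := by
      rcases (semilocalSphereValues S P c).eq_empty_or_nonempty with h0 | h0
      · exact h0
      · have := (semilocalSphereValues_nonempty_iff S P c).1 h0
        rw [← semilocalSphereValues_nonempty_iff (S \ {p₁, p₂}) P c, he] at this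
        exact absurd this Set.not_nonempty_empty
    rw [semilocalGroundEnergy, semilocalGroundEnergy, he, he', Real.sInf_empty]
    linarith
  · refine le_semilocalGroundEnergy hne' fun g hg hs hPg hn ↦ ?_
    have h1 := re_weilSemilocalQuadratic_sdiff_pair_ge_perron hg hs hp₁ hp₂ h1S h2S hne hc1 h12 hstar
    have h2 := semilocalGroundEnergy_le_re (S := S) hg hs hPg hn
    rw [hn, mul_one] at h1
    linarith

end Summit.RiemannHypothesis.RiemannHypothesis.Theorems.SemilocalDeletionPairFloor

end
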